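import Summits.AtomisticToContinuum.Crystallization.Theses.IsometryAtoms
import Summits.AtomisticToContinuum.Crystallization.Theorems.LayeredLawsSelectHcp.Negative.Threshold
import Summits.AtomisticToContinuum.Crystallization.Theorems.PalmUnimodularRigidityUnimodularEnergyLowerBound

/-!
# Negative knowledge for crux `MinimisingLawsHaveAtoms` (stmt-AtomisticToContinuum-15776), I:
# readback, "minimising = exactly `e*`", and the hard-core hypothesis is load-bearing
# (weighted lattice laws)

Standing crux disprover `cdisprove-stmt-AtomisticToContinuum-15776` (route `IsometryAtoms`),
`--supports stmt-AtomisticToContinuum-15776`.  The crux `IsometryAtoms.MinimisingLawsHaveAtoms`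
(PURITY) says: for every hard core `δ > 0` and every probability law `P` on rooted configurations
`μ : Measure ℝ³` that is a.s. `IsRootedHardCore δ`, point-stationary (Mecke identity) and MINIMISING
(`∫ rootEnergy V_LJ dP ≤ e* := ⨅_Q e_LJ(Q)`), some rooted isometry class
`rootedClass Y = {count|A(Y − q) : A linear isometry, q ∈ Y}` has positive `P`-mass.

* §0 READBACK. `minimisingLawsHaveAtoms_iff` (`Iff.rfl` with the class named);
  `integral_rootEnergy_eq_eStar` — by the landed Palm-side stability
  `UnimodularEnergy.eStar_le_integral_rootEnergy` (item 9229) a law in the frame with `∫ h ≤ e*` has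
  `∫ h = e*` EXACTLY, so `minimisingLawsHaveAtoms_iff_exact`: the crux is a statement about the laws
  sitting exactly at `e*`; mixtures cannot trade energy for structure.  `pos_rootedClass_of_dirac`:
  a Dirac law at a rooted counting measure charges its own class — a counterexample must be a law
  WITHOUT atoms on `Measure ℝ³`, i.e. a continuum mixture (this is why no `kit` computation and no
  finite family of configurations can refute the crux).
* §1 `IsPointStationaryLaw.map_smulEquiv` — the Mecke identity is covariant under re-weighting every
  configuration, `μ ↦ c • μ` (`0 < c < ∞`; a measurable automorphism `smulEquiv` of `Measure ℝ³`):
  point-stationarity does not see multiplicities.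
* §2 THE HARD-CORE HYPOTHESIS IS LOAD-BEARING (`minimisingLawsHaveAtoms_false_without_hardCore`):
  the crux with `∀ᵐ μ ∂P, IsRootedHardCore δ μ` deleted is FALSE.  Witness: the Dirac law at the
  WEIGHTED fcc lattice `c • count|fccD3 1` with `c = max 2 (e*/E₀)`, `E₀ = e(fcc, a = 1) ≤ −1/2`
  (`Threshold.energyPerParticle_fccPC_one_le`): a point-stationary probability law (§1 applied to the
  landed `FccModel.pointStationary_fccLaw`) of mean root energy `c · E₀ ≤ e*`, whose unique sample
  gives mass `c ≥ 2` to the root and therefore lies in NO rooted class (`rootedClass_subset`: class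
  members are simple counting measures).  Moral for the prover: in the frame, `IsRootedHardCore` is
  what pins `μ` to a SIMPLE counting measure; the energy hypothesis alone is blind to multiplicity
  (`∫ V d(c•μ) = c ∫ V dμ` buys any energy), and the conclusion's `count|·` format hard-wires unit
  masses.  (Parts II–IV: the minimising hypothesis, the normalisation `P(univ) = 1` and
  point-stationarity are load-bearing; the line's content stub forces a strict lattice gap.)
All `[folklore]`.
-/

noncomputable section

namespace Summit.AtomisticToContinuum.Crystallization.Theorems.MinimisingLawsHaveAtoms.Negative.Multiplicity

open MeasureTheory Set
open scoped ENNReal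
open Literature.MathematicalPhysics.StatisticalMechanics Literature.Probability.Process
open Summit.AtomisticToContinuum.Crystallization.Theses.IsometryAtoms (MinimisingLawsHaveAtoms)
open Summit.AtomisticToContinuum.Crystallization.Theorems.ChargedEnergyGapNegative (eStar eStar_le)
open Summit.AtomisticToContinuum.Crystallization.Theorems.LayeredLawsSelectHcp.Negative.DiracLaws
  (PointStationary meanRootEnergy measurableSet_singleton_count_restrict integral_dirac_of_mem
    count_restrict_singleton)
open Summit.AtomisticToContinuum.Crystallization.Theorems.LayeredLawsSelectHcp.Negative.FccLattice
  (fccD3 countable_fccD3)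
open Summit.AtomisticToContinuum.Crystallization.Theorems.LayeredLawsSelectHcp.Negative.FccModel
  (fccLaw pointStationary_fccLaw meanRootEnergy_fccLaw measurableSet_fccAtom)
open Summit.AtomisticToContinuum.Crystallization.Theorems.LayeredLawsSelectHcp.Negative.FccEnergy
  (fccPC meanRootEnergy_fccLaw_eq_energyPerParticle)
open Summit.AtomisticToContinuum.Crystallization.Theorems.LayeredLawsSelectHcp.Negative.Threshold
  (energyPerParticle_fccPC_one_le)

/-- Euclidean `3`-space. [folklore] -/
local notation "E3" => EuclideanSpace ℝ (Fin 3)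

/-! ## §0 Readback: the rooted isometry class; minimising means exactly `e*` -/

/-- **The rooted isometry class** of a point set `Y ⊆ ℝ³`: the counting measures of the rooted
isometric copies `A(Y − q)`, `A` a linear isometry, `q ∈ Y` — literally the event of the crux.
[folklore] -/
def rootedClass (Y : Set E3) : Set (Measure E3) :=
  {μ | ∃ A : E3 →ₗᵢ[ℝ] E3, ∃ q ∈ Y,
    μ = (Measure.count : Measure E3).restrict ((fun s => A (s - q)) '' Y)}

/-- The crux, read back with the class named and `e*` folded (`Iff.rfl`). [folklore] -/
theorem minimisingLawsHaveAtoms_iff :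
    MinimisingLawsHaveAtoms ↔ ∀ δ : ℝ, 0 < δ → ∀ P : Measure (Measure E3), IsProbabilityMeasure P →
      (∀ᵐ μ ∂P, IsRootedHardCore δ μ) → IsPointStationaryLaw P →
      (∫ μ, rootEnergy lennardJones μ ∂P) ≤ eStar → ∃ Y : Set E3, 0 < P (rootedClass Y) :=
  Iff.rfl

/-- **Minimising means exactly `e*`.** In the frame of the crux (probability, a.s. `δ`-hard-core,
point-stationary) the landed Palm-side stability `e* ≤ E_P[h]` (item 9229,
`UnimodularEnergy.eStar_le_integral_rootEnergy`) turns the hypothesis `E_P[h] ≤ e*` into the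
equality `E_P[h] = e*`. [folklore] -/
theorem integral_rootEnergy_eq_eStar {δ : ℝ} (hδ : 0 < δ) {P : Measure (Measure E3)}
    [IsProbabilityMeasure P] (hhc : ∀ᵐ μ ∂P, IsRootedHardCore δ μ) (hst : IsPointStationaryLaw P)
    (hE : (∫ μ, rootEnergy lennardJones μ ∂P) ≤ eStar) :
    (∫ μ, rootEnergy lennardJones μ ∂P) = eStar :=
  le_antisymm hE (UnimodularEnergy.eStar_le_integral_rootEnergy hδ hhc hst)

/-- **The crux is a statement about the laws sitting EXACTLY at `e*`**: it is equivalent to its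
restriction to laws with `E_P[h] = e*`. A counterexample must therefore have mean root energy
exactly `e*`; no slack can be traded. [folklore] -/
theorem minimisingLawsHaveAtoms_iff_exact :
    MinimisingLawsHaveAtoms ↔ ∀ δ : ℝ, 0 < δ → ∀ P : Measure (Measure E3), IsProbabilityMeasure P →
      (∀ᵐ μ ∂P, IsRootedHardCore δ μ) → IsPointStationaryLaw P →
      (∫ μ, rootEnergy lennardJones μ ∂P) = eStar → ∃ Y : Set E3, 0 < P (rootedClass Y) := by
  refine ⟨fun H δ hδ P hP hhc hst hE => H δ hδ P hP hhc hst hE.le,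
    fun H δ hδ P hP hhc hst hE => ?_⟩
  haveI := hP
  exact H δ hδ P hP hhc hst (integral_rootEnergy_eq_eStar hδ hhc hst hE)

/-- Members of a rooted class are simple: every singleton has mass `≤ 1`. [folklore] -/
theorem apply_singleton_le_one_of_mem_rootedClass {Y : Set E3} {μ : Measure E3}
    (h : μ ∈ rootedClass Y) (z : E3) : μ {z} ≤ 1 := by
  obtain ⟨A, q, -, rfl⟩ := h
  rw [Measure.restrict_apply (measurableSet_singleton z)]
  calc Measure.count ({z} ∩ ((fun s => A (s - q)) '' Y)) ≤ Measure.count ({z} : Set E3) :=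
        measure_mono inter_subset_left
    _ = 1 := Measure.count_singleton z

/-- Every rooted class lies in the measurable set `{μ | μ {0} ≤ 1}`. [folklore] -/
theorem rootedClass_subset (Y : Set E3) : rootedClass Y ⊆ {μ : Measure E3 | μ {0} ≤ 1} :=
  fun _ hμ => apply_singleton_le_one_of_mem_rootedClass hμ 0

/-- `{μ | μ {0} ≤ 1}` is measurable in the Giry σ-algebra. [folklore] -/
theorem measurableSet_setOf_apply_zero_le_one :
    MeasurableSet {μ : Measure E3 | μ {0} ≤ 1} :=
  Measure.measurable_coe (measurableSet_singleton 0) measurableSet_Iic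

/-- A rooted counting measure belongs to its own class (`A = id`, `q = 0`). [folklore] -/
theorem mem_rootedClass_self {S : Set E3} (h0 : (0 : E3) ∈ S) :
    (Measure.count : Measure E3).restrict S ∈ rootedClass S := by
  refine ⟨LinearIsometry.id, 0, h0, ?_⟩
  congr 1
  ext x
  simp

/-- **Laws with an atom at a rooted counting measure satisfy the conclusion**: the Dirac law at
`count|S` (`0 ∈ S`) charges `rootedClass S` with (outer) mass `1`. Hence a counterexample to the
crux must be a law without atoms on `Measure ℝ³` — a genuine continuum mixture of pairwise
non-isometric configurations. [folklore] -/
theorem pos_rootedClass_of_dirac {S : Set E3} (h0 : (0 : E3) ∈ S) :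
    0 < Measure.dirac ((Measure.count : Measure E3).restrict S) (rootedClass S) := by
  refine lt_of_lt_of_le one_pos ?_
  refine le_trans (le_of_eq ?_) Measure.le_dirac_apply
  rw [indicator_of_mem (mem_rootedClass_self h0), Pi.one_apply]

/-! ## §1 Re-weighting configurations: point-stationarity does not see multiplicities -/

/-- `μ ↦ c • μ` is measurable on `Measure ℝ³` (evaluations are multiplied by `c`). [folklore] -/
theorem measurable_smul_measure (c : ℝ≥0∞) : Measurable fun μ : Measure E3 => c • μ :=
  Measure.measurable_of_measurable_coe _ fun s hs => by
    simp only [Measure.smul_apply, smul_eq_mul]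
    exact (Measure.measurable_coe hs).const_mul c

/-- **Re-weighting** `μ ↦ c • μ` (`0 < c < ∞`) as a measurable automorphism of `Measure ℝ³`,
inverse `μ ↦ c⁻¹ • μ`. [folklore] -/
def smulEquiv (c : ℝ≥0∞) (h0 : c ≠ 0) (htop : c ≠ ∞) : Measure E3 ≃ᵐ Measure E3 where
  toFun μ := c • μ
  invFun μ := c⁻¹ • μ
  left_inv μ := by
    change c⁻¹ • c • μ = μ
    rw [smul_smul, ENNReal.inv_mul_cancel h0 htop, one_smul]
  right_inv μ := by
    change c • c⁻¹ • μ = μ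
    rw [smul_smul, ENNReal.mul_inv_cancel h0 htop, one_smul]
  measurable_toFun := measurable_smul_measure c
  measurable_invFun := measurable_smul_measure c⁻¹

/-- `smulEquiv c` acts by `μ ↦ c • μ`. [folklore] -/
@[simp] theorem smulEquiv_apply (c : ℝ≥0∞) (h0 : c ≠ 0) (htop : c ≠ ∞) (μ : Measure E3) :
    smulEquiv c h0 htop μ = c • μ := rfl

/-- **The Mecke identity is covariant under re-weighting**: if `P` is point-stationary then so is
its push-forward under `μ ↦ c • μ` (`0 < c < ∞`): both sides of the identity for `g` against the
re-weighted law are `c` times the two sides for `g' μ y := g (c • μ) y` against `P`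
(`(c • μ).map θ = c • μ.map θ`). Point-stationarity is blind to multiplicities. [folklore] -/
theorem _root_.Literature.Probability.Process.IsPointStationaryLaw.map_smulEquiv
    {P : Measure (Measure E3)} (hP : IsPointStationaryLaw P) (c : ℝ≥0∞) (h0 : c ≠ 0)
    (htop : c ≠ ∞) : IsPointStationaryLaw (P.map (smulEquiv c h0 htop)) := by
  intro g hg
  set g' : Measure E3 → E3 → ℝ≥0∞ := fun μ y => g (c • μ) y with hg'
  have hg'm : Measurable (Function.uncurry g') :=
    hg.comp ((measurable_smul_measure c).prodMap measurable_id)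
  rw [lintegral_map_equiv, lintegral_map_equiv]
  simp only [smulEquiv_apply, lintegral_smul_measure, Measure.map_smul, smul_eq_mul]
  rw [lintegral_const_mul' c _ htop, lintegral_const_mul' c _ htop]
  congr 1
  exact hP g' hg'm

/-! ## §2 The weighted fcc law: the hard-core hypothesis is load-bearing -/

/-- The fcc lattice at nearest-neighbour distance `1`, as a rooted counting measure. [folklore] -/
def fccOne : Measure E3 := (Measure.count : Measure E3).restrict (fccD3 1 : Set E3)

/-- Its root energy is `e(fcc, 1) ≤ −1/2` (landed lattice-sum bound). [folklore] -/
theorem rootEnergy_fccOne_le : rootEnergy lennardJones fccOne ≤ -1 / 2 := by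
  have h := meanRootEnergy_fccLaw_eq_energyPerParticle (a := 1) one_ne_zero
  rw [meanRootEnergy_fccLaw] at h
  rw [rootEnergy_def]
  change (∫ y, lennardJones ‖y‖
      ∂((Measure.count : Measure E3).restrict (fccD3 1 : Set E3))) / 2 ≤ -1 / 2
  rw [h]
  exact energyPerParticle_fccPC_one_le

/-- The root energy of `fccOne` is negative. [folklore] -/
theorem rootEnergy_fccOne_neg : rootEnergy lennardJones fccOne < 0 := by
  linarith [rootEnergy_fccOne_le]

/-- The weight `c = max 2 (e*/E₀)`, `E₀ = rootEnergy fccOne < 0`: at least `2`, and large enough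
that `c · E₀ ≤ e*` whatever the (unknown) value of `e*`. [folklore] -/
def weight : ℝ := max 2 (eStar / rootEnergy lennardJones fccOne)

/-- `2 ≤ c`. [folklore] -/
theorem two_le_weight : 2 ≤ weight := le_max_left _ _

/-- `0 < c`. [folklore] -/
theorem weight_pos : 0 < weight := by linarith [two_le_weight]

/-- `c · E₀ ≤ e*`. [folklore] -/
theorem weight_mul_le : weight * rootEnergy lennardJones fccOne ≤ eStar := by
  have hE₀ := rootEnergy_fccOne_neg
  have h1 : eStar / rootEnergy lennardJones fccOne ≤ weight := le_max_right _ _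
  have h2 := mul_le_mul_of_nonpos_right h1 hE₀.le
  rwa [div_mul_cancel₀ _ hE₀.ne] at h2

/-- The weight in `ℝ≥0∞`. [folklore] -/
def cW : ℝ≥0∞ := ENNReal.ofReal weight

/-- `cW ≠ 0`. [folklore] -/
theorem cW_ne_zero : cW ≠ 0 := (ENNReal.ofReal_pos.2 weight_pos).ne'

/-- `cW ≠ ∞`. [folklore] -/
theorem cW_ne_top : cW ≠ ∞ := ENNReal.ofReal_ne_top

/-- `cW.toReal = c`. [folklore] -/
theorem toReal_cW : cW.toReal = weight := ENNReal.toReal_ofReal weight_pos.le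

/-- `2 ≤ cW`. [folklore] -/
theorem two_le_cW : (2 : ℝ≥0∞) ≤ cW := by
  have h : ENNReal.ofReal 2 ≤ cW := ENNReal.ofReal_le_ofReal two_le_weight
  rwa [ENNReal.ofReal_ofNat] at h

/-- **The weighted fcc lattice** `c • count|fccD3 1`: mass `c ≥ 2` at every lattice point.
[folklore] -/
def weightedFcc : Measure E3 := cW • fccOne

/-- **The weighted fcc law**: the Dirac law at the weighted fcc lattice. [folklore] -/
def weightedLaw : Measure (Measure E3) := Measure.dirac weightedFcc

/-- The weighted law is a probability law. [folklore] -/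
instance : IsProbabilityMeasure weightedLaw := by
  unfold weightedLaw; infer_instance

/-- The weighted law is the push-forward of the fcc Palm law under re-weighting. [folklore] -/
theorem weightedLaw_eq_map : weightedLaw = (fccLaw 1).map (smulEquiv cW cW_ne_zero cW_ne_top) := by
  have h := MeasureTheory.Measure.map_dirac' (smulEquiv cW cW_ne_zero cW_ne_top).measurable
    ((Measure.count : Measure E3).restrict (fccD3 1 : Set E3))
  unfold fccLaw
  rw [h]
  rfl

/-- **The weighted law is point-stationary** (§1 and the landed `pointStationary_fccLaw`).
[folklore] -/
theorem isPointStationaryLaw_weightedLaw : IsPointStationaryLaw weightedLaw := by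
  rw [weightedLaw_eq_map]
  exact IsPointStationaryLaw.map_smulEquiv (P := fccLaw 1) (pointStationary_fccLaw 1) _ _ _

/-- The atom of the weighted law is a measurable singleton (image of `{count|fccD3 1}` under the
measurable automorphism `smulEquiv`). [folklore] -/
theorem measurableSet_singleton_weightedFcc :
    MeasurableSet ({weightedFcc} : Set (Measure E3)) := by
  have h : ({weightedFcc} : Set (Measure E3)) = (smulEquiv cW cW_ne_zero cW_ne_top) '' {fccOne} := by
    rw [Set.image_singleton]
    rfl
  rw [h]
  exact (MeasurableEquiv.measurableSet_image _).2 (measurableSet_fccAtom 1)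

/-- Root energy of the weighted lattice: `c · E₀`. [folklore] -/
theorem rootEnergy_weightedFcc :
    rootEnergy lennardJones weightedFcc = weight * rootEnergy lennardJones fccOne := by
  simp only [rootEnergy_def, weightedFcc, integral_smul_measure, toReal_cW, smul_eq_mul]
  ring

/-- **Mean root energy of the weighted law**: `c · E₀ ≤ e*` — the energy hypothesis of the crux
holds (genuinely: no Bochner junk value, the atom is measurable). [folklore] -/
theorem integral_rootEnergy_weightedLaw_le :
    (∫ μ, rootEnergy lennardJones μ ∂weightedLaw) ≤ eStar := by
  rw [weightedLaw, integral_dirac_of_mem measurableSet_singleton_weightedFcc, rootEnergy_weightedFcc]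
  exact weight_mul_le

/-- The weighted lattice gives mass `c` to the root. [folklore] -/
theorem weightedFcc_apply_zero : weightedFcc {0} = cW := by
  simp only [weightedFcc, fccOne, Measure.smul_apply, smul_eq_mul]
  rw [count_restrict_singleton (show (0 : E3) ∈ (fccD3 1 : Set E3) from (fccD3 1).zero_mem), mul_one]

/-- **The weighted law charges NO rooted isometry class**: its sample gives mass `c ≥ 2` to the
root, class members give mass `≤ 1` (outer-measure bound through the measurable superset
`{μ | μ {0} ≤ 1}`). [folklore] -/
theorem weightedLaw_rootedClass (Y : Set E3) : weightedLaw (rootedClass Y) = 0 := by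
  refine measure_mono_null (rootedClass_subset Y) ?_
  rw [weightedLaw, Measure.dirac_apply' _ measurableSet_setOf_apply_zero_le_one, indicator_of_notMem]
  simp only [mem_setOf_eq, not_le, weightedFcc_apply_zero]
  exact lt_of_lt_of_le ENNReal.one_lt_two two_le_cW

/-- The weighted law violates exactly the deleted hypothesis: it is NOT a.s. hard-core, for any `δ`
(a hard-core configuration gives mass `1` to the root). [folklore] -/
theorem not_ae_isRootedHardCore_weightedLaw (δ : ℝ) :
    ¬ ∀ᵐ μ ∂weightedLaw, IsRootedHardCore δ μ := by
  intro h
  have hmem : ∀ᵐ μ ∂weightedLaw, μ ∈ {μ : Measure E3 | μ {0} ≤ 1} :=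
    h.mono fun μ hμ => by
      rw [mem_setOf_eq, hμ.measure_zero_singleton]
  rw [ae_iff] at hmem
  have h0 : weightedLaw {μ : Measure E3 | μ {0} ≤ 1}ᶜ = 0 := by
    simpa only [Set.compl_def] using hmem
  rw [weightedLaw, Measure.dirac_apply' _ measurableSet_setOf_apply_zero_le_one.compl,
    indicator_of_mem] at h0
  · exact one_ne_zero h0
  · simp only [mem_compl_iff, mem_setOf_eq, not_le, weightedFcc_apply_zero]
    exact lt_of_lt_of_le ENNReal.one_lt_two two_le_cW

/-- **The hard-core hypothesis is load-bearing** (`MinimisingLawsHaveAtoms` WITHOUT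
`∀ᵐ μ ∂P, IsRootedHardCore δ μ`, stated inline, is FALSE): the weighted fcc law is a point-stationary
probability law with `E_P[h] ≤ e*` charging no rooted isometry class. Any proof of the crux must
use that `P`-a.e. configuration is a SIMPLE counting measure; the energy hypothesis is blind to
multiplicity. [folklore] -/
theorem minimisingLawsHaveAtoms_false_without_hardCore :
    ¬ (∀ P : Measure (Measure E3), IsProbabilityMeasure P → IsPointStationaryLaw P →
      (∫ μ, rootEnergy lennardJones μ ∂P) ≤
        (⨅ Q : PeriodicConfiguration 3, Q.energyPerParticle lennardJones) →
      ∃ Y : Set E3, 0 < P {μ | ∃ A : E3 →ₗᵢ[ℝ] E3, ∃ q ∈ Y,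
        μ = (Measure.count : Measure E3).restrict ((fun s => A (s - q)) '' Y)}) := by
  intro H
  obtain ⟨Y, hY⟩ := H weightedLaw inferInstance isPointStationaryLaw_weightedLaw
    integral_rootEnergy_weightedLaw_le
  exact hY.ne' (weightedLaw_rootedClass Y)

end Summit.AtomisticToContinuum.Crystallization.Theorems.MinimisingLawsHaveAtoms.Negative.Multiplicity

end
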